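import Summits.CriticalPhenomena.PercolationContinuityZ3.Theorems.PercNearOneGluingAdditiveGluingFibreLocus
import HarnessLib

/-!
# Crux `PercNearOneGluing.AdditiveGluing` (stmt-CriticalPhenomena-4576), line `tieline`:
# the b-side involution ψ_b — fibre counts of (T) reduce to the triples in which `v` hangs on `b`'s `(ω² ∪ ω³)`-component

Support file (`--supports stmt-CriticalPhenomena-4576`, helper, seat (d) exchange-certificate form).  No named facts,
no sorries, no definitions.

The kernel `stub_k0CovTransferQ_c9` ((T), roles `o b u v c`) follows from `fibreSumT o b u v c I ≥ 0` for all count vectors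
`I` (`covTransferQ_of_fibres`).  The signed summand of `fibreSumT` at a replica triple `(ω¹, ω², ω³)` is
`N₁ D₂ D₃ (ub₂ − ub₃)(vo₃ − oc₁·vc₃)` (`D = {u ↮ v}`, `ub = {u ↔ b}`, …).  EXCHCERT-g6 §5 (exact on 64 594 / 64 594 terms):
let `R` be the set of vertices joined to `b` by a path of `(ω² ∪ ω³)`-open edges avoiding `u`; if `v ∉ R`, swapping the
replica labels `2 ↔ 3` on the edges touching `R` is a count-preserving involution that exchanges `ub₂ ↔ ub₃` and fixes
every other factor (paths of `ω²`, `ω³` enter `R` only through `u`, so `u ↮ v` and `v`'s connections are decided off `R`;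
replica 1 is untouched), hence negates the summand.  Consequently (`fibreSumT_eq_sum_hanging`):

  `fibreSumT o b u v c I = Σ { summand(t) : cnt t = I, v IS joined to b by (ω² ∪ ω³)-open edges avoiding u }`,

i.e. all triples with `v ∉ R` cancel in pairs — the (CNT) count only has to be controlled on the "hanging" triples.  The
general bookkeeping (`fibreSum4_eq_sum_of_involution`: a count-preserving involution preserving a predicate `P`
and negating the summand on `{P}` reduces the fibre sum to `{¬P}`) is stated for reuse by the other partial involutions
(ψ_o, ψ_u2 of the crux memos).
[folklore] (sign-reversing involution on an invariant sub-family; 1-vertex separator surgery on open paths)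
-/

namespace Summit.CriticalPhenomena.PercolationContinuityZ3.Cruxes.AdditiveGluing.TieLine.FibreCount

open MeasureTheory Set Finset Literature.Probability.Percolation
open Literature.Probability.LatticeModels (prodBernoulli)

open Classical

/-! ### Partial involutions: reduction of a fibre sum to the complement of an invariant family -/

section Partial

variable {ι : Type*} [Fintype ι]

/-- **Partial sign-reversing involution.**  Let `Φ` be a count-preserving involution of replica triples preserving a
predicate `P`, and suppose that on every triple of the fibre `{cnt = I}` satisfying `P` where the signed summand is
non-zero, `Φ` negates the summand.  Then the fibre sum equals the sum of the summand over the triples of the fibre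
violating `P` — over any finset `S` with `t ∈ S ↔ cnt t = I ∧ ¬ P t` (stated this way to keep decidability instances out
of the conclusion). [folklore] -/
theorem fibreSum4_eq_sum_of_involution (Φ : Triple ι → Triple ι) (P : Triple ι → Prop) (I : ι → ℕ)
    (S : Finset (Triple ι)) (hS : ∀ t, t ∈ S ↔ cnt t = I ∧ ¬ P t)
    (hΦ : ∀ t, Φ (Φ t) = t) (hcnt : ∀ t, cnt (Φ t) = cnt t) (hP : ∀ t, P t → P (Φ t))
    (s₀ s₁ s₂ s₃ : ℝ) (A₀ A₁ A₂ B₀ B₁ B₂ C₀ C₁ C₂ D₀ D₁ D₂ : Set (Set ι))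
    (h : ∀ t : Triple ι, cnt t = I → P t →
      s₀ * ind A₀ A₁ A₂ t + s₁ * ind B₀ B₁ B₂ t + s₂ * ind C₀ C₁ C₂ t + s₃ * ind D₀ D₁ D₂ t ≠ 0 →
      s₀ * ind A₀ A₁ A₂ (Φ t) + s₁ * ind B₀ B₁ B₂ (Φ t) + s₂ * ind C₀ C₁ C₂ (Φ t) + s₃ * ind D₀ D₁ D₂ (Φ t) =
        -(s₀ * ind A₀ A₁ A₂ t + s₁ * ind B₀ B₁ B₂ t + s₂ * ind C₀ C₁ C₂ t + s₃ * ind D₀ D₁ D₂ t)) :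
    fibreSum4 s₀ s₁ s₂ s₃ A₀ A₁ A₂ B₀ B₁ B₂ C₀ C₁ C₂ D₀ D₁ D₂ I =
      ∑ t ∈ S, (s₀ * ind A₀ A₁ A₂ t + s₁ * ind B₀ B₁ B₂ t + s₂ * ind C₀ C₁ C₂ t + s₃ * ind D₀ D₁ D₂ t) := by
  unfold fibreSum4
  set f : Triple ι → ℝ := fun t =>
    s₀ * ind A₀ A₁ A₂ t + s₁ * ind B₀ B₁ B₂ t + s₂ * ind C₀ C₁ C₂ t + s₃ * ind D₀ D₁ D₂ t with hf
  rw [← Finset.sum_filter_add_sum_filter_not _ P]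
  have hSeq : ((Finset.univ : Finset (Triple ι)).filter (fun t => cnt t = I)).filter (fun t => ¬ P t) = S := by
    ext t; simp only [Finset.mem_filter, Finset.mem_univ, true_and, hS]
  suffices hzero : ∑ t ∈ ((Finset.univ : Finset (Triple ι)).filter (fun t => cnt t = I)).filter P, f t = 0 by
    rw [hzero, zero_add, hSeq]
  -- the sign reversal holds on the whole invariant family
  have hall : ∀ t : Triple ι, cnt t = I → P t → f (Φ t) = -f t := by
    intro t ht hPt
    by_cases h0 : f t = 0
    · by_cases h1 : f (Φ t) = 0
      · rw [h0, h1, neg_zero]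
      · have h2 : f t = -f (Φ t) := by
          have := h (Φ t) (by rw [hcnt, ht]) (hP t hPt) h1
          rwa [hΦ] at this
        exfalso; apply h1; linarith
    · exact h t ht hPt h0
  have hmem : ∀ t, t ∈ ((Finset.univ : Finset (Triple ι)).filter (fun t => cnt t = I)).filter P ↔ cnt t = I ∧ P t := by
    intro t; simp only [Finset.mem_filter, Finset.mem_univ, true_and]
  refine Finset.sum_involution (fun t _ => Φ t) (fun t ht => ?_) (fun t ht hne => ?_) (fun t ht => ?_)
    (fun t ht => hΦ t)
  · obtain ⟨ht1, ht2⟩ := (hmem t).1 ht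
    change f t + f (Φ t) = 0
    rw [hall t ht1 ht2, add_neg_cancel]
  · intro heq
    apply hne
    obtain ⟨ht1, ht2⟩ := (hmem t).1 ht
    have := hall t ht1 ht2
    rw [heq] at this
    change f t = 0
    linarith
  · obtain ⟨ht1, ht2⟩ := (hmem t).1 ht
    exact (hmem _).2 ⟨by rw [hcnt, ht1], hP t ht2⟩

end Partial

/-! ### The b-side swap `2 ↔ 3` -/

section SwapB

variable {n : ℕ}

/-- In the open graph of a configuration with all edges at `u` removed, `u` is isolated: `b ↔ u` forces `b = u`.
[folklore] -/
theorem eq_of_reachable_avoid {ω : Set (Sym2 (Fin n))} {u b : Fin n}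
    (h : (openGraph (ω \ {e | u ∈ e})).Reachable b u) : b = u := by
  rw [SimpleGraph.reachable_iff_reflTransGen] at h
  rcases Relation.ReflTransGen.cases_tail h with hbu | ⟨z, _, hzu⟩
  · exact hbu.symm
  · exfalso
    rw [openGraph_adj] at hzu
    exact hzu.1.2 (Sym2.mem_mk_right z u)

/-- Closedness modulo `{u}` of the set `O` of vertices joined to `b ≠ u` by open edges of `ω` avoiding `u`, for every
sub-configuration `η ⊆ ω`: an edge of `η` with an endpoint in `O` has both endpoints in `O ∪ {u}`. [folklore] -/
theorem closed_of_subset_reach {η ω : Set (Sym2 (Fin n))} {u b : Fin n} (hbu : b ≠ u) (hηω : η ⊆ ω) :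
    ∀ e ∈ η, ∀ x ∈ e, x ∈ {y | (openGraph (ω \ {e | u ∈ e})).Reachable b y} →
      ∀ y ∈ e, y ∈ {y | (openGraph (ω \ {e | u ∈ e})).Reachable b y} ∨ y ∈ ({u} : Set (Fin n)) := by
  intro e he x hx hxO y hy
  by_cases hyu : y = u
  · exact Or.inr (by rw [hyu]; rfl)
  · left
    simp only [Set.mem_setOf_eq] at hxO ⊢
    by_cases hxy : x = y
    · rw [← hxy]; exact hxO
    · have hxu : x ≠ u := fun hxu => hbu (eq_of_reachable_avoid (hxu ▸ hxO))
      have he' : e = s(x, y) := (Sym2.mem_and_mem_iff hxy).1 ⟨hx, hy⟩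
      refine hxO.trans (SimpleGraph.Adj.reachable ?_)
      rw [openGraph_adj]
      refine ⟨⟨hηω (he' ▸ he), ?_⟩, hxy⟩
      simp only [Set.mem_setOf_eq, Sym2.mem_iff, not_or]
      exact ⟨fun h => hxu h.symm, fun h => hyu h.symm⟩

/-- If `O` is closed modulo `{u}` for `ω`, `b ∈ O` and `u ∉ O`, then `u ↔ b` iff `b ↔ u` through open edges touching `O`.
[folklore] -/
theorem reachable_ub_iff {ω F : Set (Sym2 (Fin n))} {O : Set (Fin n)} {u b : Fin n}
    (hF : ∀ e, e ∈ F ↔ ∃ x ∈ e, x ∈ O) (hO : ∀ e ∈ ω, ∀ x ∈ e, x ∈ O → ∀ y ∈ e, y ∈ O ∨ y ∈ ({u} : Set (Fin n)))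
    (hb : b ∈ O) (hu : u ∉ O) :
    (openGraph ω).Reachable u b ↔ (openGraph (ω ∩ F)).Reachable b u := by
  constructor
  · intro hub
    obtain ⟨z, hz, hbz, _⟩ := exists_exit_of_not_mem hF hO hb hu hub.symm
    rw [Set.mem_singleton_iff] at hz
    rwa [hz] at hbz
  · intro hbu
    exact (hbu.mono (BHK2006.openGraph_le Set.inter_subset_left)).symm

/-- If `O` is closed modulo `{u}` for `ω`, `x ∈ O`, `v ∉ O` and `u ↮ v`, then `v ↮ x`. [folklore] -/
theorem not_reachable_of_mem_region {ω F : Set (Sym2 (Fin n))} {O : Set (Fin n)} {u v x : Fin n}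
    (hF : ∀ e, e ∈ F ↔ ∃ x ∈ e, x ∈ O) (hO : ∀ e ∈ ω, ∀ x ∈ e, x ∈ O → ∀ y ∈ e, y ∈ O ∨ y ∈ ({u} : Set (Fin n)))
    (hx : x ∈ O) (hv : v ∉ O) (hD : ¬ (openGraph ω).Reachable u v) : ¬ (openGraph ω).Reachable v x := by
  intro hvx
  obtain ⟨z, hz, _, hzv⟩ := exists_exit_of_not_mem hF hO hx hv hvx.symm
  rw [Set.mem_singleton_iff] at hz
  rw [hz] at hzv
  exact hD hzv

/-- The arithmetic of the b-side sign reversal (`ub₂ ↔ ub₃` exchanged, all other atoms fixed). [folklore] -/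
theorem swap23_arith (ub₂ ub₃ vo oc vc : Prop) :
    (1 * (if ub₃ ∧ vo then (1 : ℝ) else 0) + (-1) * (if ub₂ ∧ vo then (1 : ℝ) else 0) +
        (-1) * (if oc ∧ ub₃ ∧ vc then (1 : ℝ) else 0) + 1 * (if oc ∧ ub₂ ∧ vc then (1 : ℝ) else 0)) =
      -(1 * (if ub₂ ∧ vo then (1 : ℝ) else 0) + (-1) * (if ub₃ ∧ vo then (1 : ℝ) else 0) +
        (-1) * (if oc ∧ ub₂ ∧ vc then (1 : ℝ) else 0) + 1 * (if oc ∧ ub₃ ∧ vc then (1 : ℝ) else 0)) := by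
  by_cases h2 : ub₂ <;> by_cases h3 : ub₃ <;> by_cases ho : vo <;> by_cases hoc : oc <;> by_cases hvc : vc <;>
    simp [h2, h3, ho, hoc, hvc]

/-- **The b-side sign reversal.**  Let `O ∋ b` avoid `u, v` and suppose every edge of `ω² ∪ ω³` touching `O` stays in
`O ∪ {u}`.  If the signed summand of `fibreSumT` at the triple `t = (ω¹, ω², ω³)` is non-zero, the triple obtained by
swapping the labels `2 ↔ 3` on the edges touching `O` (any `Φ` realising it, hypotheses `hΦ₁ hΦ₂ hΦ₃`) has the opposite
summand. [folklore] -/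
theorem summandT_swap23_neg (o b u v c : Fin n) (F : Set (Sym2 (Fin n))) (O : Set (Fin n))
    (hF : ∀ e, e ∈ F ↔ ∃ x ∈ e, x ∈ O) (hb : b ∈ O) (hu : u ∉ O) (hv : v ∉ O)
    (t : Triple (Sym2 (Fin n)))
    (hO : ∀ e ∈ cfg t.2.1 ∪ cfg t.2.2, ∀ x ∈ e, x ∈ O → ∀ y ∈ e, y ∈ O ∨ y ∈ ({u} : Set (Fin n)))
    (Φ : Triple (Sym2 (Fin n)) → Triple (Sym2 (Fin n))) (hΦ₁ : (Φ t).1 = t.1)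
    (hΦ₂ : (Φ t).2.1 = fun i => if i ∈ F then t.2.2 i else t.2.1 i)
    (hΦ₃ : (Φ t).2.2 = fun i => if i ∈ F then t.2.1 i else t.2.2 i)
    (hne : 1 * ind ((openConn c u)ᶜ ∩ (openConn c v)ᶜ) ((openConn u v)ᶜ ∩ openConn u b) ((openConn u v)ᶜ ∩ openConn v o) t +
        (-1) * ind ((openConn c u)ᶜ ∩ (openConn c v)ᶜ) (openConn u v)ᶜ ((openConn u v)ᶜ ∩ openConn u b ∩ openConn v o) t +
        (-1) * ind ((openConn c u)ᶜ ∩ (openConn c v)ᶜ ∩ openConn o c) ((openConn u v)ᶜ ∩ openConn u b)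
          ((openConn u v)ᶜ ∩ openConn v c) t +
        1 * ind ((openConn c u)ᶜ ∩ (openConn c v)ᶜ ∩ openConn o c) (openConn u v)ᶜ
          ((openConn u v)ᶜ ∩ openConn u b ∩ openConn v c) t ≠ 0) :
    1 * ind ((openConn c u)ᶜ ∩ (openConn c v)ᶜ) ((openConn u v)ᶜ ∩ openConn u b) ((openConn u v)ᶜ ∩ openConn v o) (Φ t) +
        (-1) * ind ((openConn c u)ᶜ ∩ (openConn c v)ᶜ) (openConn u v)ᶜ ((openConn u v)ᶜ ∩ openConn u b ∩ openConn v o) (Φ t) +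
        (-1) * ind ((openConn c u)ᶜ ∩ (openConn c v)ᶜ ∩ openConn o c) ((openConn u v)ᶜ ∩ openConn u b)
          ((openConn u v)ᶜ ∩ openConn v c) (Φ t) +
        1 * ind ((openConn c u)ᶜ ∩ (openConn c v)ᶜ ∩ openConn o c) (openConn u v)ᶜ
          ((openConn u v)ᶜ ∩ openConn u b ∩ openConn v c) (Φ t) =
      -(1 * ind ((openConn c u)ᶜ ∩ (openConn c v)ᶜ) ((openConn u v)ᶜ ∩ openConn u b) ((openConn u v)ᶜ ∩ openConn v o) t +
        (-1) * ind ((openConn c u)ᶜ ∩ (openConn c v)ᶜ) (openConn u v)ᶜ ((openConn u v)ᶜ ∩ openConn u b ∩ openConn v o) t +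
        (-1) * ind ((openConn c u)ᶜ ∩ (openConn c v)ᶜ ∩ openConn o c) ((openConn u v)ᶜ ∩ openConn u b)
          ((openConn u v)ᶜ ∩ openConn v c) t +
        1 * ind ((openConn c u)ᶜ ∩ (openConn c v)ᶜ ∩ openConn o c) (openConn u v)ᶜ
          ((openConn u v)ᶜ ∩ openConn u b ∩ openConn v c) t) := by
  have hω₁' : cfg (Φ t).1 = cfg t.1 := by rw [hΦ₁]
  have hω₂' : cfg (Φ t).2.1 = (cfg t.2.1 \ F) ∪ (cfg t.2.2 ∩ F) := by rw [hΦ₂, cfg_ite]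
  have hω₃' : cfg (Φ t).2.2 = (cfg t.2.2 \ F) ∪ (cfg t.2.1 ∩ F) := by rw [hΦ₃, cfg_ite]
  simp only [ind, hω₁', hω₂', hω₃', Set.mem_inter_iff, Set.mem_compl_iff, openConn, Set.mem_setOf_eq] at hne ⊢
  set ω₁ := cfg t.1 with hω₁
  set ω₂ := cfg t.2.1 with hω₂
  set ω₃ := cfg t.2.2 with hω₃
  set ω₂' := (ω₂ \ F) ∪ (ω₃ ∩ F) with hω₂'def
  set ω₃' := (ω₃ \ F) ∪ (ω₂ ∩ F) with hω₃'def
  -- closedness of the four configurations of replicas 2, 3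
  have hO₂ : ∀ e ∈ ω₂, ∀ x ∈ e, x ∈ O → ∀ y ∈ e, y ∈ O ∨ y ∈ ({u} : Set (Fin n)) :=
    closedMod_mono hO Set.subset_union_left
  have hO₃ : ∀ e ∈ ω₃, ∀ x ∈ e, x ∈ O → ∀ y ∈ e, y ∈ O ∨ y ∈ ({u} : Set (Fin n)) :=
    closedMod_mono hO Set.subset_union_right
  have hO₂' : ∀ e ∈ ω₂', ∀ x ∈ e, x ∈ O → ∀ y ∈ e, y ∈ O ∨ y ∈ ({u} : Set (Fin n)) :=
    closedMod_mono hO (Set.union_subset (Set.sdiff_subset.trans Set.subset_union_left)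
      (Set.inter_subset_left.trans Set.subset_union_right))
  have hO₃' : ∀ e ∈ ω₃', ∀ x ∈ e, x ∈ O → ∀ y ∈ e, y ∈ O ∨ y ∈ ({u} : Set (Fin n)) :=
    closedMod_mono hO (Set.union_subset (Set.sdiff_subset.trans Set.subset_union_right)
      (Set.inter_subset_left.trans Set.subset_union_left))
  have hZ : ∀ (η : Set (Sym2 (Fin n))), ∀ z₁ ∈ ({u} : Set (Fin n)), ∀ z₂ ∈ ({u} : Set (Fin n)),
      (openGraph (η ∩ F)).Reachable z₁ z₂ → z₁ = z₂ := by
    intro η z₁ hz₁ z₂ hz₂ _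
    rw [Set.mem_singleton_iff] at hz₁ hz₂
    rw [hz₁, hz₂]
  -- Step 1: the standing constraints hold (else the summand vanishes)
  have hNu : ¬ (openGraph ω₁).Reachable c u := by
    by_contra hN; apply hne; simp [hN]
  have hNv : ¬ (openGraph ω₁).Reachable c v := by
    by_contra hN; apply hne; simp [hN]
  have hD₂ : ¬ (openGraph ω₂).Reachable u v := by
    by_contra hD; apply hne; simp [hD]
  have hD₃ : ¬ (openGraph ω₃).Reachable u v := by
    by_contra hD; apply hne; simp [hD]
  -- Step 2: connectivity between vertices outside `O` is swap-invariant
  have out₂ : ∀ {x y : Fin n}, x ∉ O → y ∉ O → ((openGraph ω₂).Reachable x y ↔ (openGraph ω₂').Reachable x y) :=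
    fun hx hy => reachable_iff_of_agree_off hF hO₂ hO₂' (hZ ω₂) (hZ ω₂') (by rw [hω₂'def, splice_diff]) hx hy
  have out₃ : ∀ {x y : Fin n}, x ∉ O → y ∉ O → ((openGraph ω₃).Reachable x y ↔ (openGraph ω₃').Reachable x y) :=
    fun hx hy => reachable_iff_of_agree_off hF hO₃ hO₃' (hZ ω₃) (hZ ω₃') (by rw [hω₃'def, splice_diff]) hx hy
  have hD₂' : ¬ (openGraph ω₂').Reachable u v := fun h' => hD₂ ((out₂ hu hv).2 h')
  have hD₃' : ¬ (openGraph ω₃').Reachable u v := fun h' => hD₃ ((out₃ hu hv).2 h')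
  -- Step 3: `v ↔ o`, `v ↔ c` in replica 3 are swap-invariant (if `o` or `c` lies in `O`, both sides are false)
  have hvx : ∀ {x : Fin n}, ((openGraph ω₃).Reachable v x ↔ (openGraph ω₃').Reachable v x) := by
    intro x
    by_cases hx : x ∈ O
    · exact ⟨fun h' => absurd h' (not_reachable_of_mem_region hF hO₃ hx hv hD₃),
        fun h' => absurd h' (not_reachable_of_mem_region hF hO₃' hx hv hD₃')⟩
    · exact out₃ hv hx
  -- Step 4: `u ↔ b` is exchanged between the replicas
  have hub₂' : (openGraph ω₂').Reachable u b ↔ (openGraph ω₃).Reachable u b := by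
    rw [reachable_ub_iff hF hO₂' hb hu, reachable_ub_iff hF hO₃ hb hu, hω₂'def, splice_inter]
  have hub₃' : (openGraph ω₃').Reachable u b ↔ (openGraph ω₂).Reachable u b := by
    rw [reachable_ub_iff hF hO₃' hb hu, reachable_ub_iff hF hO₂ hb hu, hω₃'def, splice_inter]
  -- Step 5: rewrite and conclude
  simp only [hNu, hNv, hD₂, hD₃, hD₂', hD₃', hub₂', hub₃', ← hvx, not_false_eq_true, true_and] at hne ⊢
  exact swap23_arith _ _ _ _ _

/-- Swapping two of three Booleans coordinatewise does not change their union (as configurations). [folklore] -/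
theorem cfg_union_swap {ι : Type*} (F : Set ι) (a b : ι → Bool) :
    cfg (fun i => if i ∈ F then b i else a i) ∪ cfg (fun i => if i ∈ F then a i else b i) = cfg a ∪ cfg b := by
  ext i
  simp only [cfg, Set.mem_union, Set.mem_setOf_eq]
  split_ifs <;> tauto

/-- **ψ_b: the fibre counts of (T) reduce to the hanging triples.**  For `b ≠ u` and every count vector `I`,
`fibreSumT o b u v c I` equals the sum of its signed summand over the replica triples `t = (ω¹, ω², ω³)` of the fibre
`{cnt = I}` in which `v` is joined to `b` by a path of `(ω² ∪ ω³)`-open edges avoiding `u` (any finset `S` with this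
membership, hypothesis `hS`, so that no decidability instance is fixed by the statement); all other triples cancel in
pairs under the swap `2 ↔ 3` on the edges touching `b`'s `(ω² ∪ ω³)`-component in `V ∖ {u}`. [folklore] -/
theorem fibreSumT_eq_sum_hanging (o b u v c : Fin n) (hbu : b ≠ u) (I : Sym2 (Fin n) → ℕ)
    (S : Finset (Triple (Sym2 (Fin n))))
    (hS : ∀ t, t ∈ S ↔ cnt t = I ∧ (openGraph ((cfg t.2.1 ∪ cfg t.2.2) \ {e | u ∈ e})).Reachable b v) :
    fibreSumT o b u v c I =
      ∑ t ∈ S,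
        (1 * ind ((openConn c u)ᶜ ∩ (openConn c v)ᶜ) ((openConn u v)ᶜ ∩ openConn u b) ((openConn u v)ᶜ ∩ openConn v o) t +
          (-1) * ind ((openConn c u)ᶜ ∩ (openConn c v)ᶜ) (openConn u v)ᶜ ((openConn u v)ᶜ ∩ openConn u b ∩ openConn v o) t +
          (-1) * ind ((openConn c u)ᶜ ∩ (openConn c v)ᶜ ∩ openConn o c) ((openConn u v)ᶜ ∩ openConn u b)
            ((openConn u v)ᶜ ∩ openConn v c) t +
          1 * ind ((openConn c u)ᶜ ∩ (openConn c v)ᶜ ∩ openConn o c) (openConn u v)ᶜ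
            ((openConn u v)ᶜ ∩ openConn u b ∩ openConn v c) t) := by
  unfold fibreSumT
  -- the region `O t` (b's component avoiding u in ω² ∪ ω³) and the edges `F t` touching it, kept opaque
  obtain ⟨O, hOdef⟩ : ∃ O : Triple (Sym2 (Fin n)) → Set (Fin n),
      ∀ t x, x ∈ O t ↔ (openGraph ((cfg t.2.1 ∪ cfg t.2.2) \ {e | u ∈ e})).Reachable b x :=
    ⟨fun t => {x | (openGraph ((cfg t.2.1 ∪ cfg t.2.2) \ {e | u ∈ e})).Reachable b x}, fun _ _ => Iff.rfl⟩
  obtain ⟨F, hF⟩ : ∃ F : Triple (Sym2 (Fin n)) → Set (Sym2 (Fin n)), ∀ t e, e ∈ F t ↔ ∃ x ∈ e, x ∈ O t :=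
    ⟨fun t => {e | ∃ x ∈ e, x ∈ O t}, fun _ _ => Iff.rfl⟩
  obtain ⟨Φ, hΦ₁, hΦ₂, hΦ₃⟩ : ∃ Φ : Triple (Sym2 (Fin n)) → Triple (Sym2 (Fin n)), (∀ t, (Φ t).1 = t.1) ∧
      (∀ t, (Φ t).2.1 = fun i => if i ∈ F t then t.2.2 i else t.2.1 i) ∧
      (∀ t, (Φ t).2.2 = fun i => if i ∈ F t then t.2.1 i else t.2.2 i) :=
    ⟨fun t => (t.1, fun i => if i ∈ F t then t.2.2 i else t.2.1 i, fun i => if i ∈ F t then t.2.1 i else t.2.2 i),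
      fun _ => rfl, fun _ => rfl, fun _ => rfl⟩
  -- the union `ω² ∪ ω³`, hence the region and the swapped edge set, are invariant
  have hU : ∀ t, cfg (Φ t).2.1 ∪ cfg (Φ t).2.2 = cfg t.2.1 ∪ cfg t.2.2 := fun t => by
    rw [hΦ₂, hΦ₃]; exact cfg_union_swap (F t) t.2.1 t.2.2
  have hOΦ : ∀ t, O (Φ t) = O t := fun t => by
    ext x; rw [hOdef, hOdef, hU]
  have hFΦ : ∀ t, F (Φ t) = F t := fun t => by
    ext e; rw [hF, hF, hOΦ]
  have hinv : ∀ t, Φ (Φ t) = t := by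
    intro t
    ext i
    · rw [hΦ₁, hΦ₁]
    · rw [hΦ₂, hFΦ, hΦ₂, hΦ₃]; simp only; split_ifs <;> rfl
    · rw [hΦ₃, hFΦ, hΦ₂, hΦ₃]; simp only; split_ifs <;> rfl
  have hcnt : ∀ t, cnt (Φ t) = cnt t := by
    intro t; funext i
    simp only [cnt, cnt3, hΦ₁, hΦ₂, hΦ₃]
    split_ifs
    · omega
    · rfl
  have hP : ∀ t, ¬ (openGraph ((cfg t.2.1 ∪ cfg t.2.2) \ {e | u ∈ e})).Reachable b v →
      ¬ (openGraph ((cfg (Φ t).2.1 ∪ cfg (Φ t).2.2) \ {e | u ∈ e})).Reachable b v := fun t ht => by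
    rw [hU]; exact ht
  refine fibreSum4_eq_sum_of_involution Φ
    (fun t => ¬ (openGraph ((cfg t.2.1 ∪ cfg t.2.2) \ {e | u ∈ e})).Reachable b v) I S
    (fun t => (hS t).trans (and_congr_right fun _ => not_not.symm)) hinv hcnt hP 1 (-1) (-1) 1 _ _ _ _ _ _ _ _ _ _ _ _ ?_
  · intro t ht hPt hne
    have hb : b ∈ O t := (hOdef t b).2 (SimpleGraph.Reachable.refl b)
    have hu : u ∉ O t := fun h' => hbu (eq_of_reachable_avoid ((hOdef t u).1 h'))
    have hv : v ∉ O t := fun h' => hPt ((hOdef t v).1 h')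
    have hO : ∀ e ∈ cfg t.2.1 ∪ cfg t.2.2, ∀ x ∈ e, x ∈ O t → ∀ y ∈ e, y ∈ O t ∨ y ∈ ({u} : Set (Fin n)) := by
      intro e he x hx hxO y hy
      have := closed_of_subset_reach (η := cfg t.2.1 ∪ cfg t.2.2) hbu subset_rfl e he x hx ((hOdef t x).1 hxO) y hy
      rcases this with h' | h'
      · exact Or.inl ((hOdef t y).2 h')
      · exact Or.inr h'
    exact summandT_swap23_neg o b u v c (F t) (O t) (hF t) hb hu hv t hO Φ (hΦ₁ t) (hΦ₂ t) (hΦ₃ t) hne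

end SwapB

end Summit.CriticalPhenomena.PercolationContinuityZ3.Cruxes.AdditiveGluing.TieLine.FibreCount
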